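import Literature.NumberTheory.EllipticCurves.Rank1Residual.X9MuInvariant
import Literature.NumberTheory.EllipticCurves.Rank1Residual.X9TrivialPartner
import Literature.NumberTheory.EllipticCurves.Rank1Residual.Typed.X11HidaTransfer
import HarnessLib

/-!
# BSD rank-≤1 residual cell — SOURCES of the Emerton–Pollack–Weston transfer hypothesis
# `GoodOrdinaryCharIdealMuZero` from published theorems plus finite certificates (classes X9, X11)

HONEST FRAMING (cell `b2b-bsdres-*`, verbatim): the goal of the cell is to DELETE the
COMBINATION-SHAPED residual classes for ALL analytic-rank ≤ 1 curves over ℚ — "full BSD formula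
for every rank ≤ 1 curve in class C" assembled STRICTLY from published theorems — so that the
rank-≤1 remainder becomes exactly the CONSTRUCTION-SHAPED classes, which are TYPED (missing-input
Props), NOT attempted; this is not "finishing BSD".

Theorems only (X9 prover gen 5). The X11 prover vendored Emerton–Pollack–Weston 2006 Cor. 5.1.4
(`EmertonPollackWeston2006.cor514_transfer_of_goodOrdinary`: the integral main conjecture with
`μ = 0` passes from a GOOD ORDINARY member of the Hida family `H(ρ̄)` to a MULTIPLICATIVE one) with
the source hypothesis packaged as the predicate `GoodOrdinaryCharIdealMuZero W₁ p`, and the referee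
recorded (flag `EPW06-partner-vocabulary`, F44/R32.2) that the only sources of that predicate in the
tree were construction-shaped ("an elliptic-curve partner with a known identity + μ = 0
certificate"). The X9 prover's gen-5 partner theorems MANUFACTURE such sources from PUBLISHED
theorems and FINITE certificates; this file records the one-line bridges:

* `goodOrdinaryCharIdealMuZero_of_trivialArithmetic` — a curve `A` good ordinary at `p ≥ 5` with
  `A[p]` irreducible and TRIVIAL `p`-primary arithmetic (`p ∤ #Ã(𝔽_p)`, `p ∤ ∏c_ℓ(A)`, `L(A,1)/Ω_A`
  a `p`-unit, `#Sel_{p^∞}(A/ℚ) = 1`) satisfies `GoodOrdinaryCharIdealMuZero A p` (route U2's partner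
  side, `X9TrivialPartner.lean`); `…_odd` at every odd `p` (Kato 17.4 (1) instead of BCS (a)).
* `goodOrdinaryCharIdealMuZero_of_bsdp` — a curve `A` good ordinary at `p ≥ 5`, `A[p]` irreducible,
  of analytic rank `0` with Miller's `BSD(A,p)` (e.g. `N_A < 5000`, Creutz–Miller) and ONE unit
  coefficient of `𝓛_MSD(A)` satisfies it (route U2′, `X9MuInvariant.lean`).
* `Typed.X11RankZero.bsdp_of_bsdpPartner_goodOrdinary_nonsplit` — composition with the X11 prover's
  `X11RankZero.bsdp_of_transfer_goodOrdinary_nonsplit`: an X11 pair `(E, p)` of analytic rank 0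
  (`p ≥ 5` non-split multiplicative, `E[p]` irreducible, no (ram)) congruent to such an `A` gets
  `BSD(E,p)` — every binder a PUBLISHED fact (EPW Cor. 5.1.4, Stein–Wuthrich/Jones Thm. 6.1, BCS (a),
  Greenberg 4.1, the period unit, modularity, GZK) or a FINITE certificate, apart from the X11 seat's
  own binders (`hH`, Tate parameter `q`, the multiplicative `p`-adic `L`-function datum `L`).

Scope: a good ordinary partner of a multiplicative pair exists only when `E[p]` is finite (peu
ramifié) at `p`; no pair is closed by these theorems until its certificates are lane-certified;
class labels unchanged.
-/

set_option autoImplicit false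

noncomputable section

open scoped Classical MatrixGroups ModularForm

open CongruenceSubgroup WeierstrassCurve Literature.NumberTheory.EllipticCurves
  Literature.NumberTheory.EllipticCurves.ModularForms
  Literature.NumberTheory.EllipticCurves.SteinWuthrich2013
  Literature.NumberTheory.EllipticCurves.EmertonPollackWeston2006

namespace Literature.NumberTheory.EllipticCurves.Rank1Residual

/-! ### Sources of `GoodOrdinaryCharIdealMuZero` -/

/-- **A trivial-arithmetic curve is a source for the Emerton–Pollack–Weston transfer** (`p ≥ 5`):
`GoodOrdinaryCharIdealMuZero A p` from `mazurMainConjecture_with_mu_zero_of_trivialArithmetic`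
(BCS (a) `hBCS`, Greenberg 4.1 `hGr`, period unit `hΩ`; certificates `hna`, `htam`, `hL`, `hSel`).
[cite: GreenbergLNM1716, Thm. 4.1 (p. 102) and Prop. 3.8 (p. 95)] [cite: EmertonPollackWeston2006, statement 5.1.1 (arXiv p. 30) (shape only)] -/
theorem goodOrdinaryCharIdealMuZero_of_trivialArithmetic
    (hBCS : burungale_castella_skinner_charIdeal_eq_padicLFunction)
    (hGr : greenberg_charValue_rankZero) (hΩ : realPeriodRat_eq_unit_mul_plusPeriod)
    (A : WeierstrassCurve ℚ) [A.IsElliptic] [A.IsGloballyMinimal] (p : ℕ) [Fact p.Prime]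
    (h5 : 5 ≤ p) (hgood : A.HasGoodReductionAtPrime p) (hord : ¬ (p : ℤ) ∣ A.frobeniusTrace p)
    (hirr : A.HasIrreducibleModPGaloisRep p)
    (hna : ¬ p ∣ A.reductionPointCount p) (htam : ¬ p ∣ A.tamagawaProduct)
    (hL : ∃ q : ℚ, q ≠ 0 ∧ A.entireLFunction 1 / (A.realPeriodRat : ℂ) = (q : ℂ) ∧ padicValRat p q = 0)
    (hSel : Nat.card (A.selmerGroupPInfty p) = 1) :
    GoodOrdinaryCharIdealMuZero A p := by
  intro κ γ hκ hγ hγ' _ fA hf ϖ hϖeq D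
  exact mazurMainConjecture_with_mu_zero_of_trivialArithmetic hBCS hGr hΩ A p h5 hgood hord hirr hna
    htam hL hSel κ γ hκ hγ hγ' fA hf ϖ hϖeq D

/-- **The same at every ODD good ordinary prime** (Kato 2004 Thm. 17.4 (1) `hkato` for torsion,
principal characteristic ideal from `Λ` a UFD; period unit `h5`/`h3`).
[cite: Kato2004Asterisque, Thm. 17.4 (1) (p. 273)] [cite: GreenbergLNM1716, Thm. 4.1 (p. 102)] -/
theorem goodOrdinaryCharIdealMuZero_of_trivialArithmetic_odd
    (hkato : ∀ (W : WeierstrassCurve ℚ) [W.IsElliptic] [W.IsGloballyMinimal] (p : ℕ) [Fact p.Prime]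
      (κ : ZpExtension ℚ p) (γ : Field.absoluteGaloisGroup ℚ) (N : ℕ) [NeZero N]
      (f : CuspForm (Gamma0 N) 2), kato_divisibility W p (κ := κ) (γ := γ) (f := f))
    (hGr : greenberg_charValue_rankZero) (h5 : realPeriodRat_eq_unit_mul_plusPeriod)
    (h3 : realPeriodRat_eq_unit_mul_plusPeriod_three)
    (A : WeierstrassCurve ℚ) [A.IsElliptic] [A.IsGloballyMinimal] (p : ℕ) [Fact p.Prime]
    (hp2 : p ≠ 2) (hgood : A.HasGoodReductionAtPrime p) (hord : ¬ (p : ℤ) ∣ A.frobeniusTrace p)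
    (hirr : A.HasIrreducibleModPGaloisRep p)
    (hna : ¬ p ∣ A.reductionPointCount p) (htam : ¬ p ∣ A.tamagawaProduct)
    (hL : ∃ q : ℚ, q ≠ 0 ∧ A.entireLFunction 1 / (A.realPeriodRat : ℂ) = (q : ℂ) ∧ padicValRat p q = 0)
    (hSel : Nat.card (A.selmerGroupPInfty p) = 1) :
    GoodOrdinaryCharIdealMuZero A p := by
  intro κ γ hκ hγ hγ' _ fA hf ϖ hϖeq D
  exact mazurMainConjecture_with_mu_zero_of_trivialArithmetic_odd hkato hGr h5 h3 A p hp2 hgood hord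
    hirr hna htam hL hSel κ γ hκ hγ hγ' fA hf ϖ hϖeq D

/-- **A rank-0 curve with `BSD(A,p)` known and one unit coefficient of `𝓛_MSD(A)` is a source for
the Emerton–Pollack–Weston transfer** (`p ≥ 5`): `GoodOrdinaryCharIdealMuZero A p` from
`mazurMainConjecture_with_mu_zero_of_bsdp` (BCS (a), Greenberg 4.1, period unit, modularity, GZK;
certificates `hrA`, `hbsd` — e.g. `bsdp_of_irreducible_of_conductor_lt` for `N_A < 5000` — and
`hcert`). This turns the flag `EPW06-partner-vocabulary`'s "known identity + μ = 0 certificate" into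
PUBLISHED + FINITE data for every rank-0 partner of conductor `< 5000`.
[cite: CastellaEtAl2021, Thm. 5.1.4 and its proof (§5.1.3)] [cite: Miller2011LMS, Def. 1.1]
[cite: EmertonPollackWeston2006, statement 5.1.1 (arXiv p. 30) (shape only)] -/
theorem goodOrdinaryCharIdealMuZero_of_bsdp
    (hBCS : burungale_castella_skinner_charIdeal_eq_padicLFunction)
    (hGr : greenberg_charValue_rankZero) (h5 : realPeriodRat_eq_unit_mul_plusPeriod)
    (hmodL : hasEntireLFunction_rat) (hGZK : rank_eq_analyticRank_of_analyticRank_le_one)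
    (A : WeierstrassCurve ℚ) [A.IsElliptic] [A.IsGloballyMinimal] (p : ℕ) [Fact p.Prime]
    (hp : 5 ≤ p) (hgood : A.HasGoodReductionAtPrime p) (hord : ¬ (p : ℤ) ∣ A.frobeniusTrace p)
    (hirr : A.HasIrreducibleModPGaloisRep p) (hrA : A.analyticRank = 0) (hbsd : BSDp A p)
    (hcert : ∀ [NeZero (A.conductorNorm ℤ)] (fA : CuspForm (Gamma0 (A.conductorNorm ℤ)) 2),
        IsNewformOf A fA → ∀ (ϖ : ℚ), (ϖ : ℝ) * A.realPeriodRat = plusPeriod fA →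
      ∃ n : ℕ, ‖PowerSeries.coeff n
        (PowerSeries.C (ϖ : ℚ_[p]) * padicLFunction fA (unitRoot A p : ℚ_[p]))‖ = 1) :
    GoodOrdinaryCharIdealMuZero A p := by
  intro κ γ hκ hγ hγ' _ fA hf ϖ hϖeq D
  exact mazurMainConjecture_with_mu_zero_of_bsdp hBCS hGr h5 hmodL hGZK A p hp hgood hord hirr hrA
    hbsd hcert κ γ hκ hγ hγ' fA hf ϖ hϖeq D

/-- **`N_A < 5000` version**: the partner's `BSD(A,p)` from Miller / Creutz–Miller
(`bsdp_of_irreducible_of_conductor_lt`). [cite: Miller2011LMS, Thm. 1.2] [cite: CreutzMiller2012, Thm. 1.1] -/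
theorem goodOrdinaryCharIdealMuZero_of_conductor_lt
    (hMiller : bsdp_of_irreducible_of_conductor_lt)
    (hBCS : burungale_castella_skinner_charIdeal_eq_padicLFunction)
    (hGr : greenberg_charValue_rankZero) (h5 : realPeriodRat_eq_unit_mul_plusPeriod)
    (hmodL : hasEntireLFunction_rat) (hGZK : rank_eq_analyticRank_of_analyticRank_le_one)
    (A : WeierstrassCurve ℚ) [A.IsElliptic] [A.IsGloballyMinimal] (p : ℕ) [Fact p.Prime]
    (hp : 5 ≤ p) (hgood : A.HasGoodReductionAtPrime p) (hord : ¬ (p : ℤ) ∣ A.frobeniusTrace p)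
    (hirr : A.HasIrreducibleModPGaloisRep p) (hrA : A.analyticRank = 0) (hNA : A.conductorNorm ℤ < 5000)
    (hcert : ∀ [NeZero (A.conductorNorm ℤ)] (fA : CuspForm (Gamma0 (A.conductorNorm ℤ)) 2),
        IsNewformOf A fA → ∀ (ϖ : ℚ), (ϖ : ℝ) * A.realPeriodRat = plusPeriod fA →
      ∃ n : ℕ, ‖PowerSeries.coeff n
        (PowerSeries.C (ϖ : ℚ_[p]) * padicLFunction fA (unitRoot A p : ℚ_[p]))‖ = 1) :
    GoodOrdinaryCharIdealMuZero A p :=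
  goodOrdinaryCharIdealMuZero_of_bsdp hBCS hGr h5 hmodL hGZK A p hp hgood hord hirr hrA
    (hMiller A (by omega) hNA p Fact.out hirr) hcert

/-! ### Composition with the X11 prover's transfer theorem (class X11, rank 0, non-split `p ≥ 5`) -/

/-- **X11 ∧ `r_an = 0`, non-split `p ≥ 5`: `BSD(E,p)` from a congruent rank-0 GOOD ORDINARY partner
`A` with `BSD(A,p)` (Miller / Creutz–Miller, `N_A < 5000`) and one unit coefficient of `𝓛_MSD(A)`.**
The source predicate `GoodOrdinaryCharIdealMuZero A p` comes from
`goodOrdinaryCharIdealMuZero_of_conductor_lt`; the rest is the X11 prover's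
`X11RankZero.bsdp_of_transfer_goodOrdinary_nonsplit` (Emerton–Pollack–Weston Cor. 5.1.4 `hEPW`,
Stein–Wuthrich / Jones Thm. 6.1 `hJ`, canonical multiplicative height datum `hH`, Tate parameter `q`,
the non-split multiplicative `p`-adic `L`-function `L` of `f`). `A[p]` irreducible is transported from
`E[p]` (class X11) along C1. A good ordinary partner exists only when `E[p]` is finite at `p`.
[cite: EmertonPollackWeston2006, Cor. 5.1.4 and Thm. 5.1.3 (arXiv p. 30)] [cite: SteinWuthrich2013, Thm. 6.1 (p. 20)]
[cite: Miller2011LMS, Thm. 1.2] [cite: CreutzMiller2012, Thm. 1.1] -/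
theorem Typed.X11RankZero.bsdp_of_bsdpPartner_goodOrdinary_nonsplit
    (hEPW : cor514_transfer_of_goodOrdinary)
    (hJ : thm61_nonsplitMultiplicative) (hH : exists_isMultCanonical)
    (hMiller : bsdp_of_irreducible_of_conductor_lt)
    (hBCS : burungale_castella_skinner_charIdeal_eq_padicLFunction)
    (hGr : greenberg_charValue_rankZero) (h5 : realPeriodRat_eq_unit_mul_plusPeriod)
    (hGZK : rank_eq_analyticRank_of_analyticRank_le_one) (hmod : hasEntireLFunction_rat)
    (W A : WeierstrassCurve ℚ) [W.IsElliptic] [W.IsGloballyMinimal] [A.IsElliptic] [A.IsGloballyMinimal]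
    (p : ℕ) [Fact p.Prime]
    {κ : ZpExtension ℚ p} {γ : Field.absoluteGaloisGroup ℚ} {N : ℕ} [NeZero N]
    {f : CuspForm (Gamma0 N) 2} (hp : 5 ≤ p) (hr : W.analyticRank = 0) (hX : ClassX11 W p)
    (hns : ¬ W.HasSplitMultiplicativeReductionAtPrime p)
    (hgoodA : A.HasGoodReductionAtPrime p) (hordA : ¬ (p : ℤ) ∣ A.frobeniusTrace p)
    (hrA : A.analyticRank = 0) (hNA : A.conductorNorm ℤ < 5000)
    (hcertA : ∀ [NeZero (A.conductorNorm ℤ)] (fA : CuspForm (Gamma0 (A.conductorNorm ℤ)) 2),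
        IsNewformOf A fA → ∀ (ϖ : ℚ), (ϖ : ℝ) * A.realPeriodRat = plusPeriod fA →
      ∃ n : ℕ, ‖PowerSeries.coeff n
        (PowerSeries.C (ϖ : ℚ_[p]) * padicLFunction fA (unitRoot A p : ℚ_[p]))‖ = 1)
    (hiso : ∃ e : geomTorsion A (p : ℤ) ≃+ geomTorsion W (p : ℤ),
      ∀ (σ : Field.absoluteGaloisGroup ℚ) (P : geomTorsion A (p : ℤ)), e (σ • P) = σ • e P)
    {q : ℚ_[p]} (hq0 : q ≠ 0) (hq1 : ‖q‖ < 1) (hqj : tateJ q = (W.j : ℚ_[p]))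
    (hκ : κ.IsCyclotomic) (hγ : κ.IsTopGenerator γ) (hγ' : IsCyclotomicVariable p γ)
    (hf : IsNewformOf W f) (D : W.SelmerDualData κ γ) (ϖ : ℚ) (hϖ0 : ϖ ≠ 0)
    (hϖ : (ϖ : ℝ) * W.realPeriodRat = plusPeriod f)
    (L : PowerSeries ℚ_[p]) (hL : IsMultPAdicLFunctionOf f p (-1) L) : BSDp W p := by
  obtain ⟨e, he⟩ := hiso
  have hirrA : A.HasIrreducibleModPGaloisRep p :=
    hasIrreducibleModPGaloisRep_of_torsionIso_symm e he hX.irr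
  exact Typed.X11RankZero.bsdp_of_transfer_goodOrdinary_nonsplit W p hEPW hJ hH hGZK hmod A hp hr hX hns
    hgoodA hordA ⟨e, he⟩ hirrA
    (goodOrdinaryCharIdealMuZero_of_conductor_lt hMiller hBCS hGr h5 hmod hGZK A p hp hgoodA hordA
      hirrA hrA hNA hcertA)
    hq0 hq1 hqj hκ hγ hγ' hf D ϖ hϖ0 hϖ L hL

end Literature.NumberTheory.EllipticCurves.Rank1Residual

end
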